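import Summits.BirchSwinnertonDyer.BirchSwinnertonDyer.Theorems.ManinLocalTwoThreeCDivisionGamma1Core
import Summits.BirchSwinnertonDyer.BirchSwinnertonDyer.Theorems.ManinLocalTwoThreeDivisionCoverGamma1UDC
import Summits.BirchSwinnertonDyer.BirchSwinnertonDyer.Theorems.ManinLocalTwoThreeIntegralQSeriesNearCuspB
import Summits.BirchSwinnertonDyer.BirchSwinnertonDyer.Theorems.ManinLocalTwoThreeIntegralQSeriesNearCusp
import Summits.BirchSwinnertonDyer.BirchSwinnertonDyer.Theorems.ManinLocalTwoThreeIntegralCuspPresentation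
import Literature.NumberTheory.EllipticCurves.HeegnerPointsModularityProofs
import HarnessLib

/-!
# Stevens' `c₁ = ±1` modulo CDT and the two cusp nodes (N6, N7) of the `c`-division witness

Cell `bsd-f2-manin`, prover seat p2 (gen 20); crux C2 `ManinOddAtFour` (stmt-BirchSwinnertonDyer-22967); LEAD p1 g19's DIVISION COVER ON `Γ₁(N)`
run with the **`c₁`-DIVISION point `E_f mod Λ_W` (multiplier `1`)** — the only integral choice (p2 STATUS 2026-08-30T00:39Z).

`abs_maninConstant₁_eq_one_of_CDT_of_growth_of_cuspSeries`: let `W` be globally minimal with an `X₀(N)`-datum `D` and an OPTIMAL `X₁(N)`-datum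
`D₁` (Manin constant `c₁`).  ASSUME the printed CDT fact and the two cusp nodes of an g44's node file for the `X₀`-datum — (N6) `CDivGrowth`
(exponential growth of `F ∣ g` at every cusp) and (N7) `CDivCuspSeries` (integer `q`-series of `12·℘_{Λ_W}(E_f)·Δ^a` near `i∞`, Honda at `1`),
both stated here VERBATIM as hypotheses (their proofs are p3's `…CDivisionGrowth` / `…CDivisionCuspSeries`).  THEN `|c₁| = 1`.
Proof: if `m := |c₁| ≥ 2`, take the integer presentation `(Fx, G)` of `℘_{(c₁φ(N))⁻¹Λ_W}(E_f)` (`exists_int_isXPresentation_gamma1`), the exponent `a`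
of (N6) for `(G, Γ₁^{(m)})`, and the witness `F = 12·℘_{Λ_W}(E_f)·G·Δ^a` (`exists_cDivisionWitness_of_presentation`): holomorphic, `Γ₁(N)`-stabiliser
exactly `Γ₁^{(m)} = {γ : c₁{∞,γ∞}_f ∈ mΛ_W} = {γ : {∞,γ∞}_f ∈ Λ_W}`, exponential growth (N6, transferred from `D` to `D₁`: same newform, same
lattice — `gamma1_f_eq_modular`, `gamma1_weierstrassP_eq_modular`), integer `q`-series on `ℍ` ((N7) × the integer series of `G`, (QEXNB)
`integralQSeriesNearCuspB_holds`, (QXP) `qExpansionExtensionPrinciple_holds`).  Unbounded Denominators makes `Γ₁^{(m)}` congruence, Wohlfahrt inside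
`Γ₁(N)` gives `Γ₁(N) ≤ Γ₁^{(m)}` (`DivisionGamma1.forall_gamma1_division_of_divisionWitness_of_UDW`), contradicting optimality
(`DivisionGamma1.not_forall_gamma1_division_of_isOptimal`).

HONEST FRAMING: CONDITIONAL on CDT (printed) and on the two node statements (N6), (N7) (being landed by p3 as theorems; then the hypotheses
discharge by name).  Stevens' conjecture, Manin's conjecture, C2/C3 and BSD are NOT proved by this file.
[cite: Stevens1989, §2] [cite: CalegariDimitrovTang2025, Thm. 1.0.1] [cite: Wohlfahrt1964, Thm. 2] [cite: Manin1972, Prop. 1.4] [cite: Honda1970, Thm. 9]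
-/

set_option linter.dupNamespace false
set_option autoImplicit false

noncomputable section

open Complex Filter Topology Set Function PowerSeries
open UpperHalfPlane hiding I
open scoped Real Topology Manifold MatrixGroups PeriodPair ModularForm
open ModularForm SlashInvariantForm ModularFormClass CongruenceSubgroup

open Literature.NumberTheory.EllipticCurves Literature.NumberTheory.EllipticCurves.ModularForms
open Summit.BirchSwinnertonDyer.Rank1Residual.ManinAdditive

namespace Summit.BirchSwinnertonDyer.BirchSwinnertonDyer.Theorems.ManinLocalTwoThree.CDivision

/-- **Stevens' `|c₁| = 1` ⟸ CDT ∧ (N6) ∧ (N7).**  See the module docstring.  `h6` and `h7` are the bodies of an g44's `CDivGrowth` and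
`CDivCuspSeries` VERBATIM (on `X₀`-data).  CONDITIONAL; nothing about BSD. [cite: Stevens1989, §2] [cite: CalegariDimitrovTang2025, Thm. 1.0.1] -/
theorem abs_maninConstant₁_eq_one_of_CDT_of_growth_of_cuspSeries
    (hCDT : Literature.NumberTheory.Automorphic.CalegariDimitrovTang2025_unboundedDenominators_algInt)
    (h6 : ∀ (W : WeierstrassCurve ℚ) [W.IsElliptic] [W.IsGloballyMinimal] {N : ℕ} [NeZero N] (D : ModularParametrizationData W N)
      (w : ℤ) (Bd : ModularForm (Gamma0 N) w) (Γ : Subgroup SL(2, ℤ)), Γ ≤ Gamma0 N → Γ.FiniteIndex →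
      ∃ a : ℕ, 2 ≤ a ∧ ∀ F : ℍ → ℂ, (∀ γ ∈ Γ, F ∣[w + 12 * (a : ℤ)] γ = F) →
        (∀ τ : ℍ, eichlerIntegral D.f τ ∉ D.L.lattice →
          F τ = ℘[D.L] (eichlerIntegral D.f τ) * ((12 : ℂ) * Bd τ * ModularForm.discriminant τ ^ a)) →
        ∀ g : SL(2, ℤ), ∃ C A m : ℝ, ∀ τ : ℍ, A ≤ τ.im → ‖(F ∣[w + 12 * (a : ℤ)] g) τ‖ ≤ C * Real.exp (m * τ.im))
    (h7 : ∀ (W : WeierstrassCurve ℚ) [W.IsElliptic] [W.IsGloballyMinimal] {N : ℕ} [NeZero N] (D : ModularParametrizationData W N)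
      (a : ℕ), 2 ≤ a →
      ∃ (g : ℚ⟦X⟧) (B : ℝ), (∀ n, (coeff n g).den = 1) ∧
        ∀ τ : ℍ, B < τ.im → HasSum (fun n : ℕ ↦ ((coeff n g : ℚ) : ℂ) * Function.Periodic.qParam 1 (τ : ℂ) ^ n)
          ((12 : ℂ) * ℘[D.L] (eichlerIntegral D.f τ) * ModularForm.discriminant τ ^ a))
    {W : WeierstrassCurve ℚ} [W.IsElliptic] [W.IsGloballyMinimal] {N : ℕ} [NeZero N]
    (D : ModularParametrizationData W N) (D₁ : Gamma1ParametrizationData W N) (hopt : D₁.IsOptimal) :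
    |D₁.maninConstant| = 1 := by
  have hc0 : D₁.c ≠ 0 := D₁.maninConstant_ne_zero
  have hc : (D₁.c : ℂ) ≠ 0 := Int.cast_ne_zero.mpr hc0
  have hf : D₁.f ≠ 0 := D₁.isNewformOf.1.ne_zero
  have hfD : D.f ≠ 0 := D.isNewformOf.1.ne_zero
  -- suppose `|c₁| ≥ 2`
  rw [Int.abs_eq_natAbs]
  by_contra hne
  have hm0 : D₁.c.natAbs ≠ 0 := Int.natAbs_ne_zero.mpr hc0
  have hm1 : D₁.c.natAbs ≠ 1 := fun h ↦ hne (by rw [show D₁.maninConstant = D₁.c from rfl, h]; rfl)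
  have hm2 : 2 ≤ D₁.c.natAbs := by omega
  -- the division cover group at `m = |c₁|`
  obtain ⟨Γ, hmem, hle, hfi, -⟩ := DivisionGamma1.exists_divisionCoverSubgroupGamma1 D₁ (m := D₁.c.natAbs) (by omega)
  haveI : Γ.FiniteIndex := hfi
  -- the integer presentation and the exponent `a` of (N6) (on the `X₀`-datum)
  obtain ⟨k, Fx, G, hk, hX, hint⟩ := exists_int_isXPresentation_gamma1 D₁ hc
  choose bd hbd using hint
  obtain ⟨a, ha2, hgr⟩ := h6 W D k (G : ModularForm (Gamma0 N) k) Γ (hle.trans (Gamma1_in_Gamma0 N)) hfi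
  -- the witness
  obtain ⟨F, hF, hFeq, hiff⟩ :=
    exists_cDivisionWitness_of_presentation D₁.f hf (lattice_le_mulLeft_inv_gamma1 D₁ hc) (by omega) hX a
  -- transfer to the `X₀`-datum
  have hfeq : D₁.f = D.f := gamma1_f_eq_modular D₁ D
  have hΛeq : D₁.L.lattice = D.L.lattice := gamma1_lattice_eq_modular D₁ D
  have h℘eq : ℘[D₁.L] = ℘[D.L] := gamma1_weierstrassP_eq_modular D₁ D
  have hFeqD : ∀ τ : ℍ, eichlerIntegral D.f τ ∉ D.L.lattice →
      F τ = ℘[D.L] (eichlerIntegral D.f τ) * ((12 : ℂ) * (G : ModularForm (Gamma0 N) k) τ * ModularForm.discriminant τ ^ a) := by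
    intro τ hτ
    have hτ' : eichlerIntegral D₁.f τ ∉ D₁.L.lattice := by rwa [hfeq, hΛeq]
    rw [← hFeq τ hτ', ← hfeq, ← h℘eq]
    show 12 * ℘[D₁.L] (eichlerIntegral D₁.f τ) * G τ * ModularForm.discriminant τ ^ a =
      ℘[D₁.L] (eichlerIntegral D₁.f τ) * (12 * G τ * ModularForm.discriminant τ ^ a)
    ring
  -- invariance / stabiliser in the interface of `…DivisionCoverGamma1UDC`
  have hinv : ∀ γ : Gamma1 N, (∃ ν ∈ D₁.L.lattice,
      (D₁.c : ℂ) * cuspSymbol D₁.f ⟨(γ : SL(2, ℤ)), Gamma1_in_Gamma0 N γ.2⟩ = (D₁.c.natAbs : ℂ) * ν) →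
      F ∣[k + 12 * (a : ℤ)] (γ : SL(2, ℤ)) = F := fun γ hγ ↦
    (hiff ⟨(γ : SL(2, ℤ)), Gamma1_in_Gamma0 N γ.2⟩).mp ((exists_mem_intCast_mul_eq_natAbs_mul_iff D₁.L hc0 _).mp hγ)
  have hstab : ∀ γ : Gamma1 N, F ∣[k + 12 * (a : ℤ)] (γ : SL(2, ℤ)) = F → ∃ ν ∈ D₁.L.lattice,
      (D₁.c : ℂ) * cuspSymbol D₁.f ⟨(γ : SL(2, ℤ)), Gamma1_in_Gamma0 N γ.2⟩ = (D₁.c.natAbs : ℂ) * ν := fun γ hγ ↦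
    (exists_mem_intCast_mul_eq_natAbs_mul_iff D₁.L hc0 _).mpr ((hiff ⟨(γ : SL(2, ℤ)), Gamma1_in_Gamma0 N γ.2⟩).mpr hγ)
  have hΓinv : ∀ γ ∈ Γ, F ∣[k + 12 * (a : ℤ)] γ = F := fun γ hγ ↦
    hinv ⟨γ, hle hγ⟩ ((hmem ⟨γ, hle hγ⟩).mp hγ)
  -- (N6): growth at every cusp
  have hgrowth := hgr F hΓinv hFeqD
  -- (N7) + (QEXNB) + (QXP): the integer `q`-series on `ℍ`
  obtain ⟨g, B, hgden, hΦ⟩ := h7 W D a ha2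
  obtain ⟨T, hT⟩ := exists_forall_eichlerIntegral_smul_notMem D.f hfD D.L 1
  have hBd : ∀ τ : ℍ, HasSum (fun n : ℕ ↦ (bd n : ℂ) * Complex.exp (2 * Real.pi * Complex.I * (τ : ℂ) * n))
      ((G : ModularForm (Gamma0 N) k) τ) := fun τ ↦
    ParamPoleJ.hasSum_int_qExpansion (G : ModularForm (Gamma0 N) k) bd (fun m ↦ hbd m) τ
  obtain ⟨b, B', hbB'⟩ := IntegralQSeries.integralQSeriesNearCuspB_holds
    (fun τ ↦ (12 : ℂ) * ℘[D.L] (eichlerIntegral D.f τ) * ModularForm.discriminant τ ^ a) F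
    (G : ModularForm (Gamma0 N) k) g bd hgden ⟨B, hΦ⟩ hBd
    ⟨T, fun τ hτ ↦ by rw [hFeqD τ (by simpa using hT τ hτ.le)]; ring⟩
  have hq : ∃ b : ℕ → ℂ, (∀ n, IsIntegral ℤ (b n)) ∧ ∀ τ : ℍ,
      HasSum (fun n : ℕ ↦ b n * Complex.exp (2 * Real.pi * Complex.I * (τ : ℂ) * n)) (F τ) :=
    ⟨fun n ↦ (b n : ℂ), fun n ↦ isIntegral_algebraMap (R := ℤ) (A := ℂ) (x := b n),
      IntegralQSeries.qExpansionExtensionPrinciple_holds F hF (fun n ↦ (b n : ℂ)) B' hbB'⟩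
  -- Unbounded Denominators + Wohlfahrt inside `Γ₁(N)`, against optimality
  have hall := DivisionGamma1.forall_gamma1_division_of_divisionWitness_of_UDW D₁ (m := D₁.c.natAbs) (by omega)
    (UDWOfCDT.unboundedDenominatorsWeightAlgInt_of_CDT_algInt hCDT (k + 12 * (a : ℤ))) hF hinv hstab hgrowth hq
  exact DivisionGamma1.not_forall_gamma1_division_of_isOptimal D₁ hopt hm2 hall

/-- An `X₁(N)`-datum of `W` yields an `X₀(N)`-datum of `W` (same newform and Néron lattice, integral multiplier `c₁φ(N)`: `c₁φ(N)Λ₀(f) ⊆ Λ_W`;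
the modular degree exists by the Riemann-surface theory of `X₀(N)`, tree `ModularParametrizationData.nonempty_of_isNewformOf`). [folklore] -/
theorem nonempty_modularParametrizationData_of_gamma1 {W : WeierstrassCurve ℚ} [W.IsElliptic] {N : ℕ} [NeZero N]
    (D₁ : Gamma1ParametrizationData W N) : Nonempty (ModularParametrizationData W N) := by
  have hc0 : D₁.c ≠ 0 := D₁.maninConstant_ne_zero
  have hφ : (Nat.totient N : ℤ) ≠ 0 := by exact_mod_cast (Nat.totient_pos.mpr (NeZero.pos N)).ne'
  refine ModularParametrizationData.nonempty_of_isNewformOf D₁.isNewformOf D₁.isNeronLattice (c := D₁.c * (Nat.totient N : ℤ))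
    (mul_ne_zero hc0 hφ) fun z hz ↦ ?_
  push_cast
  rw [mul_assoc]
  exact D₁.smul_periodLatticeGamma1_le _ (totient_mul_mem_periodLatticeGamma1 D₁.f hz)

/-- **Stevens' `|c₁| = 1` ⟸ CDT ∧ (N6) ∧ (N7)**, for EVERY optimal `X₁(N)`-datum of a globally minimal curve (the auxiliary `X₀`-datum of the
previous theorem is supplied by `nonempty_modularParametrizationData_of_gamma1`).  CONDITIONAL on the printed CDT fact and the two cusp node
statements; Stevens' conjecture, Manin's conjecture and BSD are NOT proved by this. [cite: Stevens1989, §2] [cite: CalegariDimitrovTang2025, Thm. 1.0.1] -/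
theorem abs_maninConstant₁_eq_one_of_CDT_of_growth_of_cuspSeries'
    (hCDT : Literature.NumberTheory.Automorphic.CalegariDimitrovTang2025_unboundedDenominators_algInt)
    (h6 : ∀ (W : WeierstrassCurve ℚ) [W.IsElliptic] [W.IsGloballyMinimal] {N : ℕ} [NeZero N] (D : ModularParametrizationData W N)
      (w : ℤ) (Bd : ModularForm (Gamma0 N) w) (Γ : Subgroup SL(2, ℤ)), Γ ≤ Gamma0 N → Γ.FiniteIndex →
      ∃ a : ℕ, 2 ≤ a ∧ ∀ F : ℍ → ℂ, (∀ γ ∈ Γ, F ∣[w + 12 * (a : ℤ)] γ = F) →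
        (∀ τ : ℍ, eichlerIntegral D.f τ ∉ D.L.lattice →
          F τ = ℘[D.L] (eichlerIntegral D.f τ) * ((12 : ℂ) * Bd τ * ModularForm.discriminant τ ^ a)) →
        ∀ g : SL(2, ℤ), ∃ C A m : ℝ, ∀ τ : ℍ, A ≤ τ.im → ‖(F ∣[w + 12 * (a : ℤ)] g) τ‖ ≤ C * Real.exp (m * τ.im))
    (h7 : ∀ (W : WeierstrassCurve ℚ) [W.IsElliptic] [W.IsGloballyMinimal] {N : ℕ} [NeZero N] (D : ModularParametrizationData W N)
      (a : ℕ), 2 ≤ a →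
      ∃ (g : ℚ⟦X⟧) (B : ℝ), (∀ n, (coeff n g).den = 1) ∧
        ∀ τ : ℍ, B < τ.im → HasSum (fun n : ℕ ↦ ((coeff n g : ℚ) : ℂ) * Function.Periodic.qParam 1 (τ : ℂ) ^ n)
          ((12 : ℂ) * ℘[D.L] (eichlerIntegral D.f τ) * ModularForm.discriminant τ ^ a))
    {W : WeierstrassCurve ℚ} [W.IsElliptic] [W.IsGloballyMinimal] {N : ℕ} [NeZero N]
    (D₁ : Gamma1ParametrizationData W N) (hopt : D₁.IsOptimal) :
    |D₁.maninConstant| = 1 := by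
  obtain ⟨D⟩ := nonempty_modularParametrizationData_of_gamma1 D₁
  exact abs_maninConstant₁_eq_one_of_CDT_of_growth_of_cuspSeries hCDT h6 h7 D D₁ hopt

end Summit.BirchSwinnertonDyer.BirchSwinnertonDyer.Theorems.ManinLocalTwoThree.CDivision

end
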